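import Mathlib
import HarnessLib
import HarnessLib.Audit
import Summits.AtomisticToContinuum.Statement

/-!
Route: CollisionlessCorners

CLOSED (retired) 2026-08-15T13:41:24Z by operator:999:1257524 — reason: not-a-thesis: assembly does not conclude the sub-problem Statement — note: D-0027 §2.1 audit (human 2026-08-15: routes that do not decide the summit are removed): the assembly concludes `Literature.MathematicalPhysics.KineticTheory.HydrodynamicLimit`, not the sub-problem statement; a NEW conforming route may be opened from the same idea (generated `closes : … → _root_.Hydr. The file is kept as the record of this route; refuted decls are indexed as negative knowledge (`ledger negatives`).

# Route CollisionlessCorners — collisionless corners price persistence — closure defects cost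
exactly N log N under the invariant law

It suffices to show X = LogPersistenceCost ∧ EnergyClosureCost ∧ MaxSpeedBound ∧
DiluteSelfConsistency, consumed through the shared
LD-transfer chain SpacetimeConsumption (= route SpacetimeExtensivity, items 3921–3928, whose decls
this route re-wants VERBATIM so they dedupe).
The route realises card collisionless-corners-log-price (spine; twin
freezing-is-the-cheapest-rebellion harvested): Loschmidt's cheapest way to
sustain an Euler-closure defect in the deterministic fixed-density hard-sphere gas is a ZERO-ENTROPY
COLLISIONLESS CORNER of the true phase space
(frozen / co-moving / counter-streaming files: no collision ever happens, free flight inside the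
model), whose price under the invariant Gibbs
law G is Θ(N log N) — log-super-extensive, not the folklore N^(4/3) and not extensive. NEW PART:
LogPersistenceCost (the momentum-closure defect
event of crux 3921 is rare at the SHARP speed, G ≤ exp(−c(N+1)log(N+1)); it implies 3921's ∀M form
by one line, proved in Sketch.lean) and
CollisionInevitability (the same law in its native currency: ≥ αN particles with ≤ K collisions on a
macroscopic interval cost exp(−cN log N)),
flanked by the matching UPPER bounds CollisionlessCornerCost / CornerDefectFloor (provable: the log
rate cannot be beaten) and the free-flight
toy FreeFlightEncounterTail. SHARED PART: EnergyClosureCost, MaxSpeedBound, MomentumClosureCost,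
DiluteSelfConsistency (verbatim).
Lean: `LogPersistenceCost ∧ EnergyClosureCost ∧ MaxSpeedBound ∧ DiluteSelfConsistency`

## Assembly
Pure logic plus log(N+1) → ∞ (all three certificates proved sorry-free in Sketch.lean):
LogPersistenceCost gives, for each M, exp(−c(N+1)log(N+1))
≤ exp(−M(N+1)) eventually, hence MomentumClosureCost (theorem
logPersistenceCost_imp_momentumClosureCost); SpacetimeConsumption applied to
MomentumClosureCost, EnergyClosureCost, MaxSpeedBound, DiluteSelfConsistency is the conjunct. All
dynamics sits in the four antecedents; all
transfer / second-law / Dafermos-stability work sits inside SpacetimeConsumption (route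
SpacetimeExtensivity 3924–3928).

Rationale: WHY THIS LINE. The LD-transfer programme (card spacetime-superextensive-ld → route
SpacetimeExtensivity; KipnisLandim1999 Ch. 10 Thm 3.1 superexponential
estimate + Radon–Nikodym/Cauchy–Schwarz transfer against the invariant law,
BodineauGallagherSaintraymond2017's L²(invariant measure) device at
tilt e^(O(N))) needs exactly one dynamical input: sustained closure defects are super-extensively
rare under G. This route prices that input from
BOTH sides with one mechanism — collision avoidance is bought with phase-space LOCALISATION
(log(number of collisions dodged) nats per particle,
Galilean co-motion makes it log-TIME, not time-extensive as for a tagged particle in the dilute gas,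
doi:10.1103/physreve.77.041117, or for KCM
activity, doi:10.1088/1751-8113/42/7/075007) and conjectures nothing is cheaper (OllaVaradhanYau1993
§1's missing ergodic input, in LD currency at
its provably minimal strength). Imported areas: large deviations of trajectory observables
(s-ensembles / activity, thermodynamic formalism of
chaotic flows: Kifer1990, Young1990), lower tails of counting functionals (Janson1997,
doi:10.1002/rsa.20590), hard-core Gibbs statics
(Ruelle1969, LebowitzPenrose1964). Versus SpacetimeExtensivity: same consumption (shared decls),
plus the collision currency, the sharp rate and
the negative-knowledge theorems; versus KineticWindows / LdDrudeFluxGibbsianity /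
EntropyBookkeeping: no entropy clock, and the corners are the
explicit reason their window/LD inputs must be stated at fixed strength; negatives index empty at
filing.

RANKED CRUXES. #0 Target (target) — X = LogPersistenceCost ∧ EnergyClosureCost ∧ MaxSpeedBound ∧
DiluteSelfConsistency (the dynamical content; the transfer chain SpacetimeConsumption turns X into
the conjunct). (why it might fail: LogPersistenceCost pins the rate at N log N — false if a cleverer
partial freezing sustains defects at cost N·ω_N with ω_N = o(log N); the shared conjuncts inherit
SpacetimeExtensivity's risks (jets below the cap, velocity tails, implosion).) [OllaVaradhanYau1993,
KipnisLandim1999, Spohn1991]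
#2 LogPersistenceCost (crux) — PERSISTENCE PRICING at the sharp speed (card P4/PP): under the
invariant homogeneous Gibbs law G_N = localGibbsLaw σ 1 0 θe (σ < σ₀ absolute, any θe), for every
window [s,s+τ], smooth vector test ψ and tolerance δ there is c > 0 with G_N(speed cap (N+1)^(1/24)
on the window ∧ |D_N| > δ) ≤ exp(−c(N+1)log(N+1)) eventually in N, where D_N is EXACTLY the
time-integrated weak-form momentum-closure defect of SpacetimeExtensivity.MomentumClosureCost
(ball-averaged fields at ℓ_N = (N+1)^(−1/4), hs pressure law). "Dodging or de-chaotifying n ≍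
N^(1/3)τ collisions costs ≥ log n nats per particle over a macroscopic volume, and nothing is
cheaper." Implies MomentumClosureCost (∀M form) by monotonicity (Sketch.lean, proved). [difficulty:
open-problem] (why it might fail: A conspiracy cheaper than corners: partial/intermittent freezing
or warm laminar textures sustaining |D_N|>δ at G-cost N·ω_N, ω_N=o(log N) (kills only this crux) or
O(N) below the cap (kills 3921 too); rigorously it is quantitative mixing of the N-sphere flow in LD
currency.) [KipnisLandim1999, OllaVaradhanYau1993, Kifer1990, Young1990, BertiniEtAl2015,
doi:10.1103/physreve.77.041117, doi:10.1088/1751-8113/42/7/075007]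
#3 CollisionInevitability (crux) — the log law in its native currency (twin card crux 1, keeper card
C3/PP): under G_N, for every macroscopic t > 0, fraction α > 0 and K ∈ ℕ there are c > 0 and N₀ such
that for N ≥ N₀ and every hard-sphere flow, G_N(at least α(N+1) particles suffer ≤ K collisions
during [0,t]) ≤ exp(−c(N+1)log(N+1)) (per-particle collision = the trajectory visits contactSet i j;
typical count ≍ σ²√θe N^(1/3) t). Two-sided with CollisionlessCornerCost (α = 1, K = 0 costs ≤
(1+κ)N log N): the LD speed of collisionlessness is exactly N log N. First step and calibration of
LogPersistenceCost; by the entropy inequality it yields "no frozen pockets" along every law of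
extensive relative entropy, in particular the evolved local Gibbs law at all times. [difficulty:
open-problem] (why it might fail: An o(N log N) way to keep αN particles collision-poor for a
macroscopic time (bubbles, expansion-fan precursors, slow particles give o(N) poor heads or log N
per head — a heuristic census); rigorously a lower-tail LD bound for the true chaotic dynamics, no
technique yet.) [doi:10.1103/physreve.77.041117, Simanyi2013, BuragoFerlegerKononenko1998,
KipnisLandim1999, OllaVaradhanYau1993]
#4 EnergyClosureCost (crux) — SHARED VERBATIM with route SpacetimeExtensivity
(stmt-AtomisticToContinuum-3923): superexponential G-cost (∀M, exp(−M(N+1)) eventually) of the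
time-integrated weak-form ENERGY-closure defect with ball-averaged fields under the speed cap
(N+1)^(1/24). Re-wanted here because the corner calibration and the transfer consumption need the
energy balance too; the frozen counter-stream corner produces no energy defect (u ≈ 0), sorted
drifting lanes do, at the same N log N price. [difficulty: open-problem] (why it might fail: As
filed by SpacetimeExtensivity: the cubic current allows short bursts; co-moving sub-block jets below
the cap were priced super-extensive (upkeep ≍ N^(27/24)) only by an entrant-count heuristic —
cheaper channel upkeep makes the cost merely exponential.) [KipnisLandim1999, BertiniEtAl2015,
Kifer1990, Young1990, Spohn1991, NachtergaeleYau2003]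
#5 MaxSpeedBound (crux) — SHARED VERBATIM with route SpacetimeExtensivity
(stmt-AtomisticToContinuum-3922): along the non-equilibrium evolution from local Gibbs data, P(some
particle exceeds speed (N+1)^(1/24) at some time in [0,t]) → 0. Not transferable from equilibrium
(one channelled fast sphere costs ≍ N^(2/3) < N) — the corner census confirms it is the ONLY
sub-extensive item in the price list. [difficulty: open-problem] (why it might fail: Want of
technique only: velocity tails along the deterministic non-equilibrium flow are beyond order-N
entropy bounds and beyond transfer; no maximum principle for hard-sphere collision cascades is known
(NachtergaeleYau2003 II.1: no proof even classically).) [NachtergaeleYau2003, OllaVaradhanYau1993,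
Literature.Barriers.AtomisticToContinuum.HighMomentumCutoff]
#6 MomentumClosureCost (crux) — SHARED VERBATIM with route SpacetimeExtensivity
(stmt-AtomisticToContinuum-3921), the ∀M superexponential form; in THIS route it is a waypoint
implied by LogPersistenceCost (theorem logPersistenceCost_imp_momentumClosureCost in Sketch.lean)
and consumed by SpacetimeConsumption; re-wanted so the item is shared, not restated. [deps:
LogPersistenceCost] [difficulty: open-problem] (why it might fail: As filed by SpacetimeExtensivity:
an unlisted O(N)-cost Euler-time-persistent sub-block mode below the speed cap; CornerDefectFloor
shows its rate can be at most (1+κ)N log N, so every proof must price collision avoidance at log N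
per head and no more.) [KipnisLandim1999, BertiniEtAl2015, Kifer1990, Young1990, Spohn1991,
Simanyi2013]
#9 SpacetimeConsumption (support) — the shared transfer chain as ONE pointer item:
MomentumClosureCost → EnergyClosureCost → MaxSpeedBound → DiluteSelfConsistency → HydrodynamicLimit.
It closes exactly when route SpacetimeExtensivity's TransferInequality (3924, static Cauchy–Schwarz
budget), BlockEntropyBudget (3925), GibbsInvariance (3926), ClosureToInBand (3927) and Assembly
(3928) are proved; not this route's bet and not staffed from here. [difficulty: L]
[KipnisLandim1999, Dafermos1979, BrezinaFeireisl2018, BodineauGallagherSaintraymond2017]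
#9 DiluteSelfConsistency (support) — SHARED VERBATIM with routes ImplosionLoophole /
SpacetimeExtensivity (stmt-AtomisticToContinuum-3091): for every η > 0 and profiles, σ₀ small puts
every classical solution with LLN data in the packing band ρσ³ < η on [0,T). The hidden PDE input of
every closure route (implosion tracking); staffed by route ImplosionLoophole. [difficulty:
open-problem] [Spohn1991]
#9 CollisionlessCornerCost (support) — THE PRICE OF THE GLOBAL CORNER (card P1/C3, twin S1; provable
now): under EVERY local Gibbs law (any continuous profiles), for σ < σ₀, every t, κ > 0 there are c
> 0, N₀ with LG_N(no collision at all during [0,t] ∧ all speeds ≤ c(N+1)^(−1/3)) ≥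
exp(−(1+κ)(N+1)log(N+1)) for N ≥ N₀ and every flow. Proof: restrict to (all pair gaps > (1+κ′)ε:
cost O(σ³N) by sequential insertion, HardSphereCanonicalTorus.Xi_succ_ge) ∩ (all |v_i| ≤ κ′ε/2t:
Gaussian small balls, log N + O(1) per particle); on it free flight has no contact on [0,t], and a
hard-sphere trajectory equals free flight up to its first collision (IsHardSphereTrajectory.free +
continuity of positions). On the event every particle moves ≤ ct(N+1)^(−1/3): all empirical fields
are frozen while Euler moves — Hilbert is defeated at LG-cost (1+o(1))N log N, so no statement on
the board may claim a faster rate. [difficulty: provable-now] [Spohn1991, KipnisLandim1999,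
Ruelle1969, Alexander1975]
#9 CornerDefectFloor (support) — THE LOG RATE IS SHARP FOR THE SHARED DEFECT EVENT (card C1): for σ
< σ₀, every θe, flow family, s ≥ 0 and τ > 0 there are a smooth test ψ and δ > 0 such that for every
κ > 0, eventually in N, G_N(cap ∧ |D_N| > δ) ≥ exp(−(1+κ)(N+1)log(N+1)) — the SAME event as
MomentumClosureCost/LogPersistenceCost. Witness: counter-streaming frozen files (velocities within
κ′ε/2τ of ±W e₁ on alternating straight files ≥ (1+κ′)ε apart, temperature or density modulated in
x₂): no collision on the window, ball fields (ρ(x₂), m ≈ 0, θ ≈ W²/3) give ∫ p ∂₂ψ₂ ≠ 0 while the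
true momentum stays put, so |D_N| ≈ τ|∫p ∂₂ψ₂|; cost = velocity aim log N per head + O(N). Uses
GibbsInvariance (3926) for s > 0. Consequence: 3921's ∀M form is consistent, any exp(−N·ω_N log N),
ω_N → ∞, is refuted in advance. [difficulty: M] [Spohn1991, KipnisLandim1999, Ruelle1969,
doi:10.1103/physreve.77.041117]
#9 FreeFlightEncounterTail (support) — THE FREE-FLIGHT TOY (twin card crux 2): same law G_N on
initial data, but particles move by FREE FLIGHT on 𝕋³ and an "encounter" of i, j is a passage of
their straight paths within ε_N = hsDiameter σ N during [0,t] (a degenerate order-2 U-statistic with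
mean ≍ N^(4/3)); claim: G_N(≥ α(N+1) particles with ≤ K encounters) ≤ exp(−c(N+1)log(N+1)) for N ≥
N₀. Upper bound (global freeze) is CollisionlessCornerCost's computation; the LOWER-tail bound needs
an entropy-of-velocity-localisation argument beyond Janson-type inequalities (which stop at
exp(−cN)); its method should transfer to CollisionInevitability (collision-poor particles DO fly
freely). [difficulty: L] [Janson1997, doi:10.1002/rsa.20590, doi:10.1103/physreve.77.041117]

TWO-LAYER PLAN. LogPersistenceCost ⇐ CollisionInevitabilityWindowed (time-integrated collision
deficit ≥ α over [s,s+τ] costs N log N) → CollisionsCloseMomentum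
(on the complement — all but αN particles collide at ≥ (1−α)·typical rate — the capped defect is
superexponentially rare: warm crowds isotropise,
cards warm-isotropises-cold-is-priced / one-flight-standard-pairs-kac) → glue by a union bound (k =
2). CollisionInevitability ⇐
FreeFlightEncounterTail-method (velocity-localisation entropy: few encounters ⇒ mutually visible
particles δ-cluster in velocity) → invasion lemma
(a collision-poor set of αN particles has a macroscopic co-moving core; thermal invaders make
boundary particles collide) → glue. CornerDefectFloor ⇐
CollisionlessCornerCost-type product estimate → LLN inside the corner event → glue.

KILL CRITERIA. (a) An explicit G-event of cost N·ω_N, ω_N = o(log N), sustaining |D_N| > δ under the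
cap refutes LogPersistenceCost: if ω_N → ∞ the route
pivots to the shared ∀M form (restate rank 2 as CollisionInevitability-driven split of 3921), if ω_N
= O(1) it closes this route AND
SpacetimeExtensivity (refuted:MomentumClosureCost) and DissipativeWeakStrong's FluxClosure in
substance. (b) ¬CollisionInevitability by an
o(N log N) collision-poor mechanism closes the route outright (the currency is wrong) — close
--reason refuted:CollisionInevitability.
(c) CornerDefectFloor or CollisionlessCornerCost REFUTED would mean the corner kinematics is wrong —
impossible short of an error in the
statement; a bounce there is repaired by restating constants. (d) MaxSpeedBound / EnergyClosureCost
/ DiluteSelfConsistency die or live with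
their home routes; if SpacetimeExtensivity closes refuted on 3921 by an O(N) mechanism, this route
closes with it; if it closes PROVED, this
route's remaining content (log sharpness, CI) is negative knowledge and the route is closed
superseded after CornerDefectFloor lands.

NOT DECOMPOSED YET. The windowed/deficit form of CollisionInevitability and the warm-closure
complement (layer-2 children of LogPersistenceCost, above); the
constant c(δ,ψ,τ,σ) ≍ (defect-carrying volume) conjectured in the card (c N V log(νt));
intermittency (many short corners vs one long one —
inside LogPersistenceCost's proof); the LLN-inside-the-corner lemma and the s > 0 shift (children of
CornerDefectFloor); energy-side corners
(sorted drifting lanes) — deliberately not filed; block/ball API definitions (deferred with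
SpacetimeExtensivity's).

CHEAPEST FALSIFIER. Pencil and paper, one page: price ANY configuration that keeps αN particles
collision-free (or |D_N| > δ) for a macroscopic time at G-cost
below αN·log N — candidates already run and failed: dilute bubbles (mean free path stays
N^(-1/3)V/α), expansion fans into vacuum (only
N^(2/3)-many collisionless precursors), slow particles (rate ≥ typical/√2,
doi:10.1103/physreve.77.041117, and staying slow costs per collision),
warm co-moving blobs (internal temperature must be N^(-2/3): the same log), lanes/beams/jets (log N
aim per head). Second cheapest: the
free-flight toy at N = 10³–10⁴ by importance sampling (kit) — estimate −log P(≥ αN encounter-poor)/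
(N log N) for α = 1/2 and watch it
stabilise; a decay to 0 kills the currency. Not run this session (kit not in this unit's payload).

NUMBERS. N+1 spheres of diameter ε = σ(N+1)^(-1/3) on 𝕋³; neighbour spacing a ≍ (N+1)^(-1/3);
collision rate ν ≍ σ²√θ N^(1/3); Euler time O(1).
Corner price per particle for time t: transverse/full velocity aim δ = κ′ε/(2t) ⇒ (3/2)log(θ/δ²) =
log N + 3 log(2t/κ′σ) + O(1) nats; positional
gaps ≥ (1+κ′)ε ⇒ O(σ³) nats; sorting a file of n = N^(1/3) particles: log n! ≈ (1/3)N^(1/3) log N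
per file (only for drifting sorted lanes).
Totals: global freeze / counter-streams (1+o(1))·N log N (CollisionlessCornerCost,
CornerDefectFloor; twin card had 1+3c with δ = N^(-1/3-c));
folklore "one O(N) fluctuation per relaxation time" N·N^(1/3) = N^(4/3) (card
spacetime-superextensive-ld) — refuted as the infimum; tagged
particle in the dilute gas: P(0 collisions in t) ≍ e^(−ωt/√2), time-extensive
(doi:10.1103/physreve.77.041117 eq. for π(n)); transfer budget
kills events of G-cost > 2c_Λ N only (SpacetimeExtensivity NUMBERS), so log N is the entire safety
margin of every LD-transfer route.
Shared exponents: ball radius (N+1)^(-1/4), cap (N+1)^(1/24) (SpacetimeExtensivity). Items at open: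
12 (5 crux, 1 target, 1 assembly, 5 support).

DEFINITION REQUESTS. None now. Per-particle collision counts, ball-averaged fields and the weak-form
defect are inlined (set-builder / let) so that every item
elaborates today (Sketch.lean rc 0); when SpacetimeExtensivity's deferred `Kinetic.blockField` /
`Kinetic.weakFormDefect` definitions are
requested, LogPersistenceCost / CornerDefectFloor should be re-pointed with them in the same edit as
3921. Bib entries prepared for
doi:10.1103/physreve.77.041117 (ViscoVanwijlandTrizac2008), doi:10.1088/1751-8113/42/7/075007
(GarrahanEtAl2009), doi:10.1002/rsa.20590
(JansonWarnke2015) — `ledger bib add` timed out twice this session (folder refs3.bib); dois used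
inline.

Novelty: Searches (2026-08-15): all 135 cards of the sub and all 30 route files in Theses/ (grep
corner|frozen|collision-free|N log N|inevitab: only the
spine card, its retired twin, warm-isotropises-cold-is-priced and SpacetimeExtensivity's prose
mention lanes/jets; no route prices collision
avoidance or states a log law); `ledger negatives --problem AtomisticToContinuum` (0); `lit frontier
AtomisticToContinuum --since 2021` (30 rows;
nearest JSP 2026 doi:10.1007/s10955-026-03570-w moderate deviations for a binary collision model,
CanestrariLiveraniOlla2026); `lit bridges
AtomisticToContinuum --cross any` (nothing on trajectory LD); `lit search --source zbmath "hard
spheres large deviations collisions"` (1: Heydecker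
arXiv:2103.14550, Kac model); `lit search --source s2 "hard sphere gas probability collision free
trajectories large deviations Gibbs"` (→
doi:10.1103/physreve.77.041117, READ: tagged-particle collision-number LD, P(N=0,t) ~ e^(−ωt/√2));
`lit search --source crossref "Garrahan Jack
Lecomte first-order dynamical phase transition"` (doi:10.1103/physrevlett.98.195702,
doi:10.1088/1751-8113/42/7/075007); `lit search --source
zbmath "lower tail subgraph counts large deviations Janson inequality"` (doi:10.1002/rsa.20590);
`lit galaxy search "first-order dynamical phase
transition" --star all` (10 rows, physics LD/cloning, nothing on Hamiltonian gases); local searchd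
down (connection reset), OpenAlex budget
exhausted, arXiv 429 — recorded in NOTES.md.
Nearest prior art found: d  [refs: 10.1007/s10955-026-03570-w, 10.1103/physreve.77.041117, 10.1103/physrevlett.98.195702, 10.1088/1751-8113/42/7/075007, 10.1002/rsa.20590, 2103.14550, doi:10.1007/s10955-026-03570-w, doi:10.1103/physreve.77.041117, doi:10.1103/physrevlett.98.195702, doi:10.1088/1751-8113/42/7/075007, doi:10.1002/rsa.20590, CanestrariLiveraniOlla2026, KipnisLandim1999]

Barriers (technique_class: ld-calibration, zero-entropy-corners, cs-transfer): - technique_class: ld-calibration, zero-entropy-corners, cs-transfer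
- Literature.Barriers.AtomisticToContinuum.BoltzmannHypothesisBarrier: USED, not evaded — its
kernels (ideal gas: any velocity law stationary; hard rods) are embedded as measure-zero invariant
corners of THIS model below close packing and priced as rare events;
LogPersistenceCost/CollisionInevitability are the quantitative Boltzmann hypothesis in LD currency
at its weakest consumable strength (equilibrium law, upper bounds, finite N), and are visibly false
for the kernels (cost O(N) there) — consistent, nothing re-wanted.
- Literature.Barriers.AtomisticToContinuum.BoltzmannHypothesisBarrierNarrow: same; no classification
of stationary states is attempted.
- Literature.Barriers.AtomisticToContinuum.MacroErgodicityBarrier: not met (no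
one-block/entropy-clock step; Euler scale; the sector-condition kernel is irrelevant).
- Literature.Barriers.AtomisticToContinuum.HighMomentumCutoffBarrier: MET honestly through the
shared MaxSpeedBound (a polynomial HighMomentumCutoff); the corner census explains why it alone is
sub-extensive (channelled sphere ≍ N^(2/3)) and cannot be transferred.
- Literature.Barriers.AtomisticToContinuum.HighMomentumCutoffBarrierNarrow: same; corners themselves
are cold/slow and never touch it.
- Literature.Barriers.AtomisticToContinuum.VelocityReversalBarrier: respected — every item is a
statement about laws / LD rates, and the corner strategy is CHEAPER than Loschmidt reversal (which
pays t

History (route lifecycle, newest last):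
- 2026-08-15T12:09:30Z · rev 1: dropped Target — drop the optional rank-0 Target block: it is the bare conjunction LogPersistenceCost ∧ EnergyClosureCost ∧ MaxSpeedBound ∧ DiluteSelfConsistency of items 7014/3 (planner-plancard-AtomisticToContinuum-Hydrody-b2c25ff8-0)
- 2026-08-15T13:41:24Z · CLOSED retired — not-a-thesis: assembly does not conclude the sub-problem Statement (operator:999:1257524)

sub-problem: HydrodynamicLimit · status: closed(retired) · opened planner-plancard-AtomisticToContinuum-Hydrody-b2c25ff8-0 2026-08-15T11:59:58Z · rev 1 · ledger route-AtomisticToContinuum-CollisionlessCorners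
GENERATED by the gate from the ledger (D-0016/17). Provers cite these decls: `theorem foo : Summit.AtomisticToContinuum.HydrodynamicLimit.Theses.CollisionlessCorners.<Decl> := …` in Summits/AtomisticToContinuum/HydrodynamicLimit/Theorems/<Name>.lean.
-/

namespace Summit.AtomisticToContinuum.HydrodynamicLimit.Theses.CollisionlessCorners

open scoped BigOperators Topology Manifold Classical MeasureTheory ProbabilityTheory Matrix InnerProductSpace ComplexConjugate ContinuousMap
open Filter Set Function TopologicalSpace MeasureTheory

attribute [summit_statement] _root_.HydrodynamicLimit

/-- item stmt-AtomisticToContinuum-7014 · crux · rank 2 · closed · moot by None · by planner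
why it might fail: A conspiracy cheaper than corners: partial/intermittent freezing or warm laminar textures sustaining |D_N|>δ at G-cost N·ω_N, ω_N=o(log N) (kills only this crux) or O(N) below the cap (kills 3921 too); rigorously it is quantitative mixing of the N-sphere flow in LD currency.
sources: KipnisLandim1999, OllaVaradhanYau1993, Kifer1990, Young1990, BertiniEtAl2015, doi:10.1103/physreve.77.041117
[crux] PERSISTENCE PRICING at the sharp speed (card P4/PP): under the invariant homogeneous Gibbs
law G_N = localGibbsLaw σ 1 0 θe (σ < σ₀ absolute, any θe), for every window [s,s+τ], smooth vector
test ψ and tolerance δ there is c > 0 with G_N(speed cap (N+1)^(1/24) on the window ∧ |D_N| > δ) ≤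
exp(−c(N+1)log(N+1)) eventually in N, where D_N is EXACTLY the time-integrated weak-form
momentum-closure defect of SpacetimeExtensivity.MomentumClosureCost (ball-averaged fields at ℓ_N =
(N+1)^(−1/4), hs pressure law). "Dodging or de-chaotifying n ≍ N^(1/3)τ collisions costs ≥ log n
nats per particle over a macroscopic volume, and nothing is cheaper." Implies MomentumClosureCost
(∀M form) by monotonicity (Sketch.lean, proved). [difficulty: open-problem] -/
@[route_item "route-AtomisticToContinuum-CollisionlessCorners"]
def LogPersistenceCost : Prop :=
  ∃ σ₀ : ℝ, 0 < σ₀ ∧ ∀ σ : ℝ, 0 < σ → σ < σ₀ → ∀ θe : ℝ, 0 < θe → ∀ Φ : (N : ℕ) → Literature.Analysis.FluidPDE.HardSphereFlow (Literature.Analysis.FluidPDE.Torus.geometry (Fin 3)) (Literature.MathematicalPhysics.KineticTheory.hsDiameter σ N) (N + 1), ∀ (s τ : ℝ), 0 ≤ s → 0 < τ → ∀ ψ : ℝ → Literature.MathematicalPhysics.KineticTheory.T3 → Literature.MathematicalPhysics.KineticTheory.V3, Literature.Analysis.FunctionSpaces.Torus.IsSmoothSpaceTimeOn (Set.Icc s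 (s + τ)) ψ → ∀ δ : ℝ, 0 < δ → ∃ c : ℝ, 0 < c ∧ ∀ᶠ N : ℕ in Filter.atTop, Literature.MathematicalPhysics.KineticTheory.localGibbsLaw σ (fun _ => 1) (fun _ => 0) (fun _ => θe) N (Φ N) {z | (∀ r ∈ Set.Icc s (s + τ), ∀ i, ‖((Φ N).flow r z i).2‖ ≤ ((N + 1 : ℕ) : ℝ) ^ (1 / 24 : ℝ)) ∧ δ < |(let ℓ : ℝ := ((N + 1 : ℕ) : ℝ) ^ (-(1 / 4 : ℝ)); let χ : Literature.MathematicalPhysics.KineticTheory.T3 → Literature.MathematicalPhysics.KineticTheory.T3 → ℝ := fun x y => if Literature.Analysis.FluidPDE.Torus.euclidDist x y < ℓ then (4 / 3 * Real.pi * ℓ ^ 3)⁻¹ else 0; let ρ : ℝ → Literature.MathematicalPhysics.KineticTheory.T3 → ℝ := fun r x => Literature.MathematicalPhysics.KineticTheory.empiricalDensityField ((Φ N).flow r z) (χ x); let m : ℝ → Literature.MathematicalPhysics.KineticTheory.T3 → Literature.MathematicalPhysics.KineticTheory.V3 := fun r x => Literature.MathematicalPhysics.KineticTheory.empiricalMomentumField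 ((Φ N).flow r z) (χ x); let e : ℝ → Literature.MathematicalPhysics.KineticTheory.T3 → ℝ := fun r x => Literature.MathematicalPhysics.KineticTheory.empiricalEnergyField ((Φ N).flow r z) (χ x); let p : ℝ → Literature.MathematicalPhysics.KineticTheory.T3 → ℝ := fun r x => Literature.MathematicalPhysics.KineticTheory.hsPressure σ (ρ r x) (2 / 3 * (e r x / ρ r x - ‖m r x‖ ^ 2 / (2 * ρ r x ^ 2))); let Mt : ℝ → (Literature.MathematicalPhysics.KineticTheory.T3 → Literature.MathematicalPhysics.KineticTheory.V3) → ℝ := fun r g => ∑ j, (Literature.MathematicalPhysics.KineticTheory.empiricalMomentumField ((Φ N).flow r z) (fun y => g y j)) j; Mt (s + τ) (ψ (s + τ)) - Mt s (ψ s) - ∫ r in s..(s + τ), (Mt r (Literature.Analysis.FunctionSpaces.Torus.timeDerivWithin (Set.Icc s (s + τ)) ψ r) + ∫ x, ((∑ i, ∑ j, (Literature.Analysis.FunctionSpaces.Torus.partialDeriv i (ψ r) x) j * (m r x i * m r x j / ρ r x)) + p r x * Literature.Analysis.FunctionSpaces.Torus.divergence (ψ r) x)))|} ≤ ENNReal.ofReal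 (Real.exp (-(c * ((N + 1) * Real.log (N + 1)))))

/-- item stmt-AtomisticToContinuum-7015 · crux · rank 3 · closed · moot by None · by planner
why it might fail: An o(N log N) way to keep αN particles collision-poor for a macroscopic time (bubbles, expansion-fan precursors, slow particles give o(N) poor heads or log N per head — a heuristic census); rigorously a lower-tail LD bound for the true chaotic dynamics, no technique yet.
sources: doi:10.1103/physreve.77.041117, Simanyi2013, BuragoFerlegerKononenko1998, KipnisLandim1999, OllaVaradhanYau1993
[crux] the log law in its native currency (twin card crux 1, keeper card C3/PP): under G_N, for
every macroscopic t > 0, fraction α > 0 and K ∈ ℕ there are c > 0 and N₀ such that for N ≥ N₀ and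
every hard-sphere flow, G_N(at least α(N+1) particles suffer ≤ K collisions during [0,t]) ≤
exp(−c(N+1)log(N+1)) (per-particle collision = the trajectory visits contactSet i j; typical count ≍
σ²√θe N^(1/3) t). Two-sided with CollisionlessCornerCost (α = 1, K = 0 costs ≤ (1+κ)N log N): the LD
speed of collisionlessness is exactly N log N. First step and calibration of LogPersistenceCost; by
the entropy inequality it yields "no frozen pockets" along every law of extensive relative entropy,
in particular the evolved local Gibbs law at all times. [difficulty: open-problem] -/
@[route_item "route-AtomisticToContinuum-CollisionlessCorners"]
def CollisionInevitability : Prop :=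
  ∃ σ₀ : ℝ, 0 < σ₀ ∧ ∀ σ : ℝ, 0 < σ → σ < σ₀ → ∀ θe : ℝ, 0 < θe → ∀ t : ℝ, 0 < t → ∀ α : ℝ, 0 < α → ∀ K : ℕ, ∃ c : ℝ, 0 < c ∧ ∃ N₀ : ℕ, ∀ N : ℕ, N₀ ≤ N → ∀ Φ : Literature.Analysis.FluidPDE.HardSphereFlow (Literature.Analysis.FluidPDE.Torus.geometry (Fin 3)) (Literature.MathematicalPhysics.KineticTheory.hsDiameter σ N) (N + 1), Literature.MathematicalPhysics.KineticTheory.localGibbsLaw σ (fun _ => 1) (fun _ => 0) (fun _ => θe) N Φ {z | α * ((N : ℝ) + 1) ≤ (({i : Fin (N + 1) | ({r : ℝ | r ∈ Set.Icc (0 : ℝ) t ∧ ∃ j : Fin (N + 1), j ≠ i ∧ Φ.flow r z ∈ Literature.Analysis.FluidPDE.contactSet (Literature.Analysis.FluidPDE.Torus.geometry (Fin 3)) (N + 1) (Literature.MathematicalPhysics.KineticTheory.hsDiameter σ N) i j}).ncard ≤ K} : Set (Fin (N + 1))).ncard : ℝ)} ≤ ENNReal.ofReal (Real.exp (-(c *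 (((N : ℝ) + 1) * Real.log ((N : ℝ) + 1)))))

/-- item stmt-AtomisticToContinuum-3923 · crux · rank 4 · closed · moot by None · by planner
why it might fail: As filed by SpacetimeExtensivity: the cubic current allows short bursts; co-moving sub-block jets below the cap were priced super-extensive (upkeep ≍ N^(27/24)) only by an entrant-count heuristic — cheaper channel upkeep makes the cost merely exponential.
sources: KipnisLandim1999, BertiniEtAl2015, Kifer1990, Young1990, Spohn1991, NachtergaeleYau2003
[crux] SUPEREXPONENTIAL EQUILIBRIUM COST OF SUSTAINED ENERGY-CLOSURE DEFECTS: as MomentumClosureCost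
with the energy balance: for φ : ℝ → 𝕋³ → ℝ smooth on [s,s+τ], D^E_N(z) = ⟨φ(s+τ), e_N(s+τ)⟩ −
⟨φ(s), e_N(s)⟩ − ∫_s^{s+τ} [⟨∂_rφ, e_N(r)⟩ + ∫ (E + p) u·∇φ dx] dr with raw empirical energy field
e_N and ball-averaged (ρ, u, E, p = hsPressure σ ρ θ); same cap (N+1)^{1/24}, same G_N, bound
exp(−M(N+1)) eventually for every M. Includes the Euler heat-flux closure q = 0 at scales ≥ ℓ_N
(conductive flux ≍ N^{-1/12} → 0) and the cubic convective current; the cap exponent must satisfy κ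
< 1/9 − γ/3 = 1/12 (energy jets, NUMBERS). [deps: GibbsInvariance] [difficulty: open-problem] -/
@[route_item "route-AtomisticToContinuum-CollisionlessCorners"]
def EnergyClosureCost : Prop :=
  ∃ σ₀ : ℝ, 0 < σ₀ ∧ ∀ σ : ℝ, 0 < σ → σ < σ₀ → ∀ θe : ℝ, 0 < θe → ∀ Φ : (N : ℕ) → Literature.Analysis.FluidPDE.HardSphereFlow (Literature.Analysis.FluidPDE.Torus.geometry (Fin 3)) (Literature.MathematicalPhysics.KineticTheory.hsDiameter σ N) (N + 1), ∀ (s τ : ℝ), 0 ≤ s → 0 < τ → ∀ φ : ℝ → Literature.MathematicalPhysics.KineticTheory.T3 → ℝ, Literature.Analysis.FunctionSpaces.Torus.IsSmoothSpaceTimeOn (Set.Icc s (s + τ)) φ → ∀ δ : ℝ, 0 < δ → ∀ M : ℝ, ∀ᶠ N : ℕ in Filter.atTop, Literature.MathematicalPhysics.KineticTheory.localGibbsLaw σ (fun _ => 1) (fun _ => 0) (fun _ => θe) N (Φ N) {z | (∀ r ∈ Set.Icc s (s + τ), ∀ i, ‖((Φ N).flow r z i).2‖ ≤ ((N + 1 :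 ℕ) : ℝ) ^ (1 / 24 : ℝ)) ∧ δ < |(let ℓ : ℝ := ((N + 1 : ℕ) : ℝ) ^ (-(1 / 4 : ℝ)); let χ : Literature.MathematicalPhysics.KineticTheory.T3 → Literature.MathematicalPhysics.KineticTheory.T3 → ℝ := fun x y => if Literature.Analysis.FluidPDE.Torus.euclidDist x y < ℓ then (4 / 3 * Real.pi * ℓ ^ 3)⁻¹ else 0; let ρ : ℝ → Literature.MathematicalPhysics.KineticTheory.T3 → ℝ := fun r x => Literature.MathematicalPhysics.KineticTheory.empiricalDensityField ((Φ N).flow r z) (χ x); let m : ℝ → Literature.MathematicalPhysics.KineticTheory.T3 → Literature.MathematicalPhysics.KineticTheory.V3 := fun r x => Literature.MathematicalPhysics.KineticTheory.empiricalMomentumField ((Φ N).flow r z) (χ x); let e : ℝ → Literature.MathematicalPhysics.KineticTheory.T3 → ℝ := fun r x => Literature.MathematicalPhysics.KineticTheory.empiricalEnergyField ((Φ N).flow r z) (χ x); let p : ℝ → Literature.MathematicalPhysics.KineticTheory.T3 → ℝ := fun r x => Literature.MathematicalPhysics.KineticTheory.hsPressure σ (ρ r x) (2 / 3 * (e r x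 / ρ r x - ‖m r x‖ ^ 2 / (2 * ρ r x ^ 2))); let Et : ℝ → (Literature.MathematicalPhysics.KineticTheory.T3 → ℝ) → ℝ := fun r g => Literature.MathematicalPhysics.KineticTheory.empiricalEnergyField ((Φ N).flow r z) g; Et (s + τ) (φ (s + τ)) - Et s (φ s) - ∫ r in s..(s + τ), (Et r (Literature.Analysis.FunctionSpaces.Torus.timeDerivWithin (Set.Icc s (s + τ)) φ r) + ∫ x, (e r x + p r x) * (∑ i, (m r x i / ρ r x) * (Literature.Analysis.FunctionSpaces.Torus.gradient (φ r) x) i)))|} ≤ ENNReal.ofReal (Real.exp (-(M * (N + 1))))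

/-- item stmt-AtomisticToContinuum-3922 · crux · rank 5 · closed · moot by None · by planner
why it might fail: Want of technique only: velocity tails along the deterministic non-equilibrium flow are beyond order-N entropy bounds and beyond transfer; no maximum principle for hard-sphere collision cascades is known (NachtergaeleYau2003 II.1: no proof even classically).
sources: NachtergaeleYau2003, OllaVaradhanYau1993, Literature.Barriers.AtomisticToContinuum.HighMomentumCutoff
[crux] MAX-SPEED BOUND ALONG THE NON-EQUILIBRIUM FLOW (card crux 2; polynomial HighMomentumCutoff):
for continuous positive profiles ∃ σ₀ ∀ σ<σ₀ ∀ t ≥ 0 ∀ flows: localGibbsLaw σ a₀ u₀ θ₀ N {z | ∃ r ∈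
[0,t], ∃ i, (N+1)^{1/24} < |v_i(Φ_N(r) z)|} → 0. Physically the max speed is ≍ √(θ_max log N); the
statement is needed because a single channelled fast sphere makes an O(1) energy-flux defect at
equilibrium cost ≍ N^{2/3} < N, which Cauchy–Schwarz cannot exclude, and because co-moving jets
price closure defects (sub-)extensively without a cap. Shared physics with cards
kinetic-energy-surgery-max-speed / apriori-tails-and-rattlers and item 0781. [difficulty:
open-problem] -/
@[route_item "route-AtomisticToContinuum-CollisionlessCorners"]
def MaxSpeedBound : Prop :=
  ∀ (a₀ θ₀ : Literature.MathematicalPhysics.KineticTheory.T3 → ℝ) (u₀ : Literature.MathematicalPhysics.KineticTheory.T3 → Literature.MathematicalPhysics.KineticTheory.V3), Continuous a₀ → Continuous θ₀ → Continuous u₀ → (∀ x, 0 < a₀ x) → (∀ x, 0 < θ₀ x) → ∃ σ₀ : ℝ, 0 < σ₀ ∧ ∀ σ : ℝ, 0 < σ → σ < σ₀ → ∀ t : ℝ, 0 ≤ t → ∀ Φ : (N : ℕ) → Literature.Analysis.FluidPDE.HardSphereFlow (Literature.Analysis.FluidPDE.Torus.geometry (Fin 3)) (Literature.MathematicalPhysics.KineticTheory.hsDiameter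 σ N) (N + 1), Filter.Tendsto (fun N : ℕ => Literature.MathematicalPhysics.KineticTheory.localGibbsLaw σ a₀ u₀ θ₀ N (Φ N) {z | ∃ r ∈ Set.Icc 0 t, ∃ i, ((N + 1 : ℕ) : ℝ) ^ (1 / 24 : ℝ) < ‖((Φ N).flow r z i).2‖}) Filter.atTop (nhds 0)

/-- item stmt-AtomisticToContinuum-3921 · crux · rank 6 · closed · moot by None · by planner
why it might fail: As filed by SpacetimeExtensivity: an unlisted O(N)-cost Euler-time-persistent sub-block mode below the speed cap; CornerDefectFloor shows its rate can be at most (1+κ)N log N, so every proof must price collision avoidance at log N per head and no more.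
sources: KipnisLandim1999, BertiniEtAl2015, Kifer1990, Young1990, Spohn1991, Simanyi2013
[crux] SUPEREXPONENTIAL EQUILIBRIUM COST OF SUSTAINED MOMENTUM-CLOSURE DEFECTS (card crux 1;
deterministic analogue of KipnisLandim1999 Ch.10 Thm 3.1): ∃ σ₀ ∀ σ<σ₀ ∀ θe>0 ∀ flows ∀ 0≤s, τ>0 ∀ ψ
: ℝ → 𝕋³ → ℝ³ smooth on [s,s+τ] ∀ δ>0 ∀ M: eventually in N, G_N( {∀ r∈[s,s+τ] ∀ i, |v_i(r)| ≤
(N+1)^{1/24}} ∩ {|D_N| > δ} ) ≤ exp(−M(N+1)), where G_N = localGibbsLaw σ 1 0 θe N (canonical,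
homogeneous, flow-invariant) and D_N(z) = ⟨ψ(s+τ), m_N(s+τ)⟩ − ⟨ψ(s), m_N(s)⟩ − ∫_s^{s+τ} [⟨∂_rψ,
m_N(r)⟩ + ∫_{𝕋³} (Σ_ij ∂_iψ_j ρu_iu_j + hsPressure σ ρ θ · div ψ)(r,x) dx] dr, with m_N the raw
empirical momentum field and (ρ, ρu, E = ρ(|u|²/2 + 3θ/2)) the ball-averaged empirical fields of
radius ℓ_N = (N+1)^{-1/4} at (r,x). Heuristic: every sub-block mode feeding the momentum flux
relaxes in ≤ N^{-1/6} Euler time and costs O(N·volume fraction) to re-create; jets/beams need the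
speed cap (see NUMBERS). [deps: GibbsInvariance] [difficulty: open-problem] -/
@[route_item "route-AtomisticToContinuum-CollisionlessCorners"]
def MomentumClosureCost : Prop :=
  ∃ σ₀ : ℝ, 0 < σ₀ ∧ ∀ σ : ℝ, 0 < σ → σ < σ₀ → ∀ θe : ℝ, 0 < θe → ∀ Φ : (N : ℕ) → Literature.Analysis.FluidPDE.HardSphereFlow (Literature.Analysis.FluidPDE.Torus.geometry (Fin 3)) (Literature.MathematicalPhysics.KineticTheory.hsDiameter σ N) (N + 1), ∀ (s τ : ℝ), 0 ≤ s → 0 < τ → ∀ ψ : ℝ → Literature.MathematicalPhysics.KineticTheory.T3 → Literature.MathematicalPhysics.KineticTheory.V3, Literature.Analysis.FunctionSpaces.Torus.IsSmoothSpaceTimeOn (Set.Icc s (s + τ)) ψ → ∀ δ : ℝ, 0 < δ → ∀ M : ℝ, ∀ᶠ N : ℕ in Filter.atTop, Literature.MathematicalPhysics.KineticTheory.localGibbsLaw σ (fun _ => 1) (fun _ => 0) (fun _ => θe) N (Φ N) {z | (∀ r ∈ Set.Icc s (s + τ), ∀ i, ‖((Φ N).flow r z i).2‖ ≤ ((N +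 1 : ℕ) : ℝ) ^ (1 / 24 : ℝ)) ∧ δ < |(let ℓ : ℝ := ((N + 1 : ℕ) : ℝ) ^ (-(1 / 4 : ℝ)); let χ : Literature.MathematicalPhysics.KineticTheory.T3 → Literature.MathematicalPhysics.KineticTheory.T3 → ℝ := fun x y => if Literature.Analysis.FluidPDE.Torus.euclidDist x y < ℓ then (4 / 3 * Real.pi * ℓ ^ 3)⁻¹ else 0; let ρ : ℝ → Literature.MathematicalPhysics.KineticTheory.T3 → ℝ := fun r x => Literature.MathematicalPhysics.KineticTheory.empiricalDensityField ((Φ N).flow r z) (χ x); let m : ℝ → Literature.MathematicalPhysics.KineticTheory.T3 → Literature.MathematicalPhysics.KineticTheory.V3 := fun r x => Literature.MathematicalPhysics.KineticTheory.empiricalMomentumField ((Φ N).flow r z) (χ x); let e : ℝ → Literature.MathematicalPhysics.KineticTheory.T3 → ℝ := fun r x => Literature.MathematicalPhysics.KineticTheory.empiricalEnergyField ((Φ N).flow r z) (χ x); let p : ℝ → Literature.MathematicalPhysics.KineticTheory.T3 → ℝ := fun r x => Literature.MathematicalPhysics.KineticTheory.hsPressure σ (ρ r x) (2 / 3 * (e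 r x / ρ r x - ‖m r x‖ ^ 2 / (2 * ρ r x ^ 2))); let Mt : ℝ → (Literature.MathematicalPhysics.KineticTheory.T3 → Literature.MathematicalPhysics.KineticTheory.V3) → ℝ := fun r g => ∑ j, (Literature.MathematicalPhysics.KineticTheory.empiricalMomentumField ((Φ N).flow r z) (fun y => g y j)) j; Mt (s + τ) (ψ (s + τ)) - Mt s (ψ s) - ∫ r in s..(s + τ), (Mt r (Literature.Analysis.FunctionSpaces.Torus.timeDerivWithin (Set.Icc s (s + τ)) ψ r) + ∫ x, ((∑ i, ∑ j, (Literature.Analysis.FunctionSpaces.Torus.partialDeriv i (ψ r) x) j * (m r x i * m r x j / ρ r x)) + p r x * Literature.Analysis.FunctionSpaces.Torus.divergence (ψ r) x)))|} ≤ ENNReal.ofReal (Real.exp (-(M * (N + 1))))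

/-- item stmt-AtomisticToContinuum-3091 · support · rank 9 · open · by planner
sources: Spohn1991
[crux] (card crux 1B ∪ 3; the hidden PDE crux of every route) for every η > 0 and all continuous
positive profiles there is σ₀ > 0 such that for 0 < σ < σ₀, every classical hard-sphere-Euler
solution on [0,T) whose t = 0 fields are the LLN limit of the local Gibbs laws satisfies ρ_t(x)σ³ <
η for all t < T and x — i.e. limsup_{σ→0} σ³ sup_{t<T*_σ} ‖ρ_σ(t)‖_∞ = 0 profile by profile. For
profiles whose ideal-gas development is global or breaks by a non-degenerate shock (Luk–Speck /
Buckmaster–Shkoller–Vicol open sets) this is stability of shock formation under an O(σ³)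
equation-of-state and data perturbation; in general it is a σ-uniform density bound at the FIRST
singularity of 3-D compressible Euler for all smooth data. [deps: EosContinuity,
LocalGibbsDensityLimit] [difficulty: open-problem] -/
@[route_item "route-AtomisticToContinuum-CollisionlessCorners"]
def DiluteSelfConsistency : Prop :=
  ∀ η : ℝ, 0 < η → ∀ (a₀ θ₀ : Literature.MathematicalPhysics.KineticTheory.T3 → ℝ) (u₀ : Literature.MathematicalPhysics.KineticTheory.T3 → Literature.MathematicalPhysics.KineticTheory.V3), Continuous a₀ → Continuous θ₀ → Continuous u₀ → (∀ x, 0 < a₀ x) → (∀ x, 0 < θ₀ x) → ∃ σ₀ : ℝ, 0 < σ₀ ∧ ∀ σ : ℝ, 0 < σ → σ < σ₀ → ∀ (T : ℝ) (ρ θ : ℝ → Literature.MathematicalPhysics.KineticTheory.T3 → ℝ) (u : ℝ → Literature.MathematicalPhysics.KineticTheory.T3 → Literature.MathematicalPhysics.KineticTheory.V3), Literature.MathematicalPhysics.KineticTheory.IsHardSphereEulerSolution σ T ρ u θ → ∀ Φ : (N : ℕ) → Literature.Analysis.FluidPDE.HardSphereFlow (Literature.Analysis.FluidPDE.Torus.geometry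 (Fin 3)) (Literature.MathematicalPhysics.KineticTheory.hsDiameter σ N) (N + 1), Literature.MathematicalPhysics.KineticTheory.TendstoHydroFieldsAt (fun N => Literature.MathematicalPhysics.KineticTheory.localGibbsLaw σ a₀ u₀ θ₀ N (Φ N)) Φ ρ u θ 0 → ∀ t ∈ Set.Ico 0 T, ∀ x, ρ t x * σ ^ 3 < η

/-- item stmt-AtomisticToContinuum-7016 · support · rank 9 · closed · moot by None · by planner
sources: KipnisLandim1999, Dafermos1979, BrezinaFeireisl2018, BodineauGallagherSaintraymond2017
[support] the shared transfer chain as ONE pointer item: MomentumClosureCost → EnergyClosureCost →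
MaxSpeedBound → DiluteSelfConsistency → HydrodynamicLimit. It closes exactly when route
SpacetimeExtensivity's TransferInequality (3924, static Cauchy–Schwarz budget), BlockEntropyBudget
(3925), GibbsInvariance (3926), ClosureToInBand (3927) and Assembly (3928) are proved; not this
route's bet and not staffed from here. [difficulty: L] -/
@[route_item "route-AtomisticToContinuum-CollisionlessCorners"]
def SpacetimeConsumption : Prop :=
  MomentumClosureCost → EnergyClosureCost → MaxSpeedBound → DiluteSelfConsistency → Literature.MathematicalPhysics.KineticTheory.HydrodynamicLimit

/-- item stmt-AtomisticToContinuum-7017 · support · rank 9 · closed · moot by None · by planner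
sources: Spohn1991, KipnisLandim1999, Ruelle1969, Alexander1975
[support] THE PRICE OF THE GLOBAL CORNER (card P1/C3, twin S1; provable now): under EVERY local
Gibbs law (any continuous profiles), for σ < σ₀, every t, κ > 0 there are c > 0, N₀ with LG_N(no
collision at all during [0,t] ∧ all speeds ≤ c(N+1)^(−1/3)) ≥ exp(−(1+κ)(N+1)log(N+1)) for N ≥ N₀
and every flow. Proof: restrict to (all pair gaps > (1+κ′)ε: cost O(σ³N) by sequential insertion,
HardSphereCanonicalTorus.Xi_succ_ge) ∩ (all |v_i| ≤ κ′ε/2t: Gaussian small balls, log N + O(1) per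
particle); on it free flight has no contact on [0,t], and a hard-sphere trajectory equals free
flight up to its first collision (IsHardSphereTrajectory.free + continuity of positions). On the
event every particle moves ≤ ct(N+1)^(−1/3): all empirical fields are frozen while Euler moves —
Hilbert is defeated at LG-cost (1+o(1))N log N, so no statement on the board may claim a faster
rate. [difficulty: provable-now] -/
@[route_item "route-AtomisticToContinuum-CollisionlessCorners"]
def CollisionlessCornerCost : Prop :=
  ∀ (a₀ θ₀ : Literature.MathematicalPhysics.KineticTheory.T3 → ℝ) (u₀ : Literature.MathematicalPhysics.KineticTheory.T3 → Literature.MathematicalPhysics.KineticTheory.V3), Continuous a₀ → Continuous θ₀ → Continuous u₀ → (∀ x, 0 < a₀ x) → (∀ x, 0 < θ₀ x) → ∃ σ₀ : ℝ, 0 < σ₀ ∧ ∀ σ : ℝ, 0 < σ → σ < σ₀ → ∀ t : ℝ, 0 < t → ∀ κ : ℝ, 0 < κ → ∃ c : ℝ, 0 < c ∧ ∃ N₀ : ℕ, ∀ N : ℕ, N₀ ≤ N → ∀ Φ : Literature.Analysis.FluidPDE.HardSphereFlow (Literature.Analysis.FluidPDE.Torus.geometry (Fin 3)) (Literature.MathematicalPhysics.KineticTheory.hsDiameter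 σ N) (N + 1), ENNReal.ofReal (Real.exp (-((1 + κ) * (((N : ℝ) + 1) * Real.log ((N : ℝ) + 1))))) ≤ Literature.MathematicalPhysics.KineticTheory.localGibbsLaw σ a₀ u₀ θ₀ N Φ {z | (∀ r ∈ Set.Icc (0 : ℝ) t, r ∉ Literature.Analysis.FluidPDE.collisionTimes (Literature.Analysis.FluidPDE.Torus.geometry (Fin 3)) (Literature.MathematicalPhysics.KineticTheory.hsDiameter σ N) (fun r' => Φ.flow r' z)) ∧ ∀ i, ‖(z i).2‖ ≤ c * ((N : ℝ) + 1) ^ (-(1 / 3 : ℝ))}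

/-- item stmt-AtomisticToContinuum-7018 · support · rank 9 · closed · moot by None · by planner
sources: Spohn1991, KipnisLandim1999, Ruelle1969, doi:10.1103/physreve.77.041117
[support] THE LOG RATE IS SHARP FOR THE SHARED DEFECT EVENT (card C1): for σ < σ₀, every θe, flow
family, s ≥ 0 and τ > 0 there are a smooth test ψ and δ > 0 such that for every κ > 0, eventually in
N, G_N(cap ∧ |D_N| > δ) ≥ exp(−(1+κ)(N+1)log(N+1)) — the SAME event as
MomentumClosureCost/LogPersistenceCost. Witness: counter-streaming frozen files (velocities within
κ′ε/2τ of ±W e₁ on alternating straight files ≥ (1+κ′)ε apart, temperature or density modulated in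
x₂): no collision on the window, ball fields (ρ(x₂), m ≈ 0, θ ≈ W²/3) give ∫ p ∂₂ψ₂ ≠ 0 while the
true momentum stays put, so |D_N| ≈ τ|∫p ∂₂ψ₂|; cost = velocity aim log N per head + O(N). Uses
GibbsInvariance (3926) for s > 0. Consequence: 3921's ∀M form is consistent, any exp(−N·ω_N log N),
ω_N → ∞, is refuted in advance. [difficulty: M] -/
@[route_item "route-AtomisticToContinuum-CollisionlessCorners"]
def CornerDefectFloor : Prop :=
  ∃ σ₀ : ℝ, 0 < σ₀ ∧ ∀ σ : ℝ, 0 < σ → σ < σ₀ → ∀ θe : ℝ, 0 < θe → ∀ Φ : (N : ℕ) → Literature.Analysis.FluidPDE.HardSphereFlow (Literature.Analysis.FluidPDE.Torus.geometry (Fin 3)) (Literature.MathematicalPhysics.KineticTheory.hsDiameter σ N) (N + 1), ∀ (s τ : ℝ), 0 ≤ s → 0 < τ → ∃ ψ : ℝ → Literature.MathematicalPhysics.KineticTheory.T3 → Literature.MathematicalPhysics.KineticTheory.V3, Literature.Analysis.FunctionSpaces.Torus.IsSmoothSpaceTimeOn (Set.Icc s (s + τ)) ψ ∧ ∃ δ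 : ℝ, 0 < δ ∧ ∀ κ : ℝ, 0 < κ → ∀ᶠ N : ℕ in Filter.atTop, ENNReal.ofReal (Real.exp (-((1 + κ) * ((N + 1) * Real.log (N + 1))))) ≤ Literature.MathematicalPhysics.KineticTheory.localGibbsLaw σ (fun _ => 1) (fun _ => 0) (fun _ => θe) N (Φ N) {z | (∀ r ∈ Set.Icc s (s + τ), ∀ i, ‖((Φ N).flow r z i).2‖ ≤ ((N + 1 : ℕ) : ℝ) ^ (1 / 24 : ℝ)) ∧ δ < |(let ℓ : ℝ := ((N + 1 : ℕ) : ℝ) ^ (-(1 / 4 : ℝ)); let χ : Literature.MathematicalPhysics.KineticTheory.T3 → Literature.MathematicalPhysics.KineticTheory.T3 → ℝ := fun x y => if Literature.Analysis.FluidPDE.Torus.euclidDist x y < ℓ then (4 / 3 * Real.pi * ℓ ^ 3)⁻¹ else 0; let ρ : ℝ → Literature.MathematicalPhysics.KineticTheory.T3 → ℝ := fun r x => Literature.MathematicalPhysics.KineticTheory.empiricalDensityField ((Φ N).flow r z) (χ x); let m : ℝ → Literature.MathematicalPhysics.KineticTheory.T3 → Literature.MathematicalPhysics.KineticTheory.V3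 := fun r x => Literature.MathematicalPhysics.KineticTheory.empiricalMomentumField ((Φ N).flow r z) (χ x); let e : ℝ → Literature.MathematicalPhysics.KineticTheory.T3 → ℝ := fun r x => Literature.MathematicalPhysics.KineticTheory.empiricalEnergyField ((Φ N).flow r z) (χ x); let p : ℝ → Literature.MathematicalPhysics.KineticTheory.T3 → ℝ := fun r x => Literature.MathematicalPhysics.KineticTheory.hsPressure σ (ρ r x) (2 / 3 * (e r x / ρ r x - ‖m r x‖ ^ 2 / (2 * ρ r x ^ 2))); let Mt : ℝ → (Literature.MathematicalPhysics.KineticTheory.T3 → Literature.MathematicalPhysics.KineticTheory.V3) → ℝ := fun r g => ∑ j, (Literature.MathematicalPhysics.KineticTheory.empiricalMomentumField ((Φ N).flow r z) (fun y => g y j)) j; Mt (s + τ) (ψ (s + τ)) - Mt s (ψ s) - ∫ r in s..(s + τ), (Mt r (Literature.Analysis.FunctionSpaces.Torus.timeDerivWithin (Set.Icc s (s + τ)) ψ r) + ∫ x, ((∑ i, ∑ j, (Literature.Analysis.FunctionSpaces.Torus.partialDeriv i (ψ r) x) j * (m r x i * m r x j / ρ r x)) + p r x * Literature.Analysis.FunctionSpaces.Torus.divergence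 (ψ r) x)))|}

/-- item stmt-AtomisticToContinuum-7019 · support · rank 9 · closed · moot by None · by planner
sources: Janson1997, doi:10.1002/rsa.20590, doi:10.1103/physreve.77.041117
[support] THE FREE-FLIGHT TOY (twin card crux 2): same law G_N on initial data, but particles move
by FREE FLIGHT on 𝕋³ and an "encounter" of i, j is a passage of their straight paths within ε_N =
hsDiameter σ N during [0,t] (a degenerate order-2 U-statistic with mean ≍ N^(4/3)); claim: G_N(≥
α(N+1) particles with ≤ K encounters) ≤ exp(−c(N+1)log(N+1)) for N ≥ N₀. Upper bound (global freeze)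
is CollisionlessCornerCost's computation; the LOWER-tail bound needs an
entropy-of-velocity-localisation argument beyond Janson-type inequalities (which stop at exp(−cN));
its method should transfer to CollisionInevitability (collision-poor particles DO fly freely).
[difficulty: L] -/
@[route_item "route-AtomisticToContinuum-CollisionlessCorners"]
def FreeFlightEncounterTail : Prop :=
  ∃ σ₀ : ℝ, 0 < σ₀ ∧ ∀ σ : ℝ, 0 < σ → σ < σ₀ → ∀ θe : ℝ, 0 < θe → ∀ t : ℝ, 0 < t → ∀ α : ℝ, 0 < α → ∀ K : ℕ, ∃ c : ℝ, 0 < c ∧ ∃ N₀ : ℕ, ∀ N : ℕ, N₀ ≤ N → ∀ Φ : Literature.Analysis.FluidPDE.HardSphereFlow (Literature.Analysis.FluidPDE.Torus.geometry (Fin 3)) (Literature.MathematicalPhysics.KineticTheory.hsDiameter σ N) (N + 1), Literature.MathematicalPhysics.KineticTheory.localGibbsLaw σ (fun _ => 1) (fun _ => 0) (fun _ => θe) N Φ {z | α * ((N : ℝ) + 1) ≤ (({i : Fin (N + 1) | ({j : Fin (N + 1) | j ≠ i ∧ ∃ r ∈ Set.Icc (0 : ℝ) t, Literature.Analysis.FluidPDE.Torus.euclidDist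 ((Literature.Analysis.FluidPDE.freeFlight (Literature.Analysis.FluidPDE.Torus.geometry (Fin 3)) r z i).1) ((Literature.Analysis.FluidPDE.freeFlight (Literature.Analysis.FluidPDE.Torus.geometry (Fin 3)) r z j).1) ≤ Literature.MathematicalPhysics.KineticTheory.hsDiameter σ N}).ncard ≤ K} : Set (Fin (N + 1))).ncard : ℝ)} ≤ ENNReal.ofReal (Real.exp (-(c * (((N : ℝ) + 1) * Real.log ((N : ℝ) + 1)))))

/-- item stmt-AtomisticToContinuum-7020 · assembly · rank 1 · closed · moot by None · by planner
sources: KipnisLandim1999, Spohn1991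
[assembly] LogPersistenceCost → EnergyClosureCost → MaxSpeedBound → DiluteSelfConsistency →
SpacetimeConsumption → HydrodynamicLimit. -/
@[route_item "route-AtomisticToContinuum-CollisionlessCorners"]
def Assembly : Prop :=
  LogPersistenceCost → EnergyClosureCost → MaxSpeedBound → DiluteSelfConsistency → SpacetimeConsumption → Literature.MathematicalPhysics.KineticTheory.HydrodynamicLimit

end Summit.AtomisticToContinuum.HydrodynamicLimit.Theses.CollisionlessCorners
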